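import Mathlib
import HarnessLib
import Summits.HubbardSuperconductivity.HubbardSuperconductivity.Theorems.KLProgrammeKLRegimeVolumeLimitInverseDressing
import Summits.HubbardSuperconductivity.HubbardSuperconductivity.Theorems.KLProgrammeKLRegimeVolumeLimitNestedCarrierRate
import Summits.HubbardSuperconductivity.HubbardSuperconductivity.Theorems.KLProgrammeKLRegimeVolumeLimitV14StubVlBound

/-!
# Child `KLRegimeVolumeLimitV14` (stmt-HubbardSuperconductivity-19921): THE REGISTERED BARE STUB `stub_vl_carrierRate` FROM THE FRAMED EXPORT
# (cell gate-hubbard-kl, seat hubbard-kl-k3c5-p2 g5, technique «analytic-continuation-free assembly via FinalTwoLegVolLimit»; `--supports` the VL child)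

`…VolumeLimitV14OfFramedCarrierRate` closes the child DIRECTLY from the framed export (the same-cutoff two-volume rate of the engine's own
last-scale two-leg kernel `klSelfEnergy L M β U μ K klE0 (nScales β + 1)` at the admissible frame `K` of the binders).  This file shows that
the framed export also yields the REGISTERED open stub of skeleton «cauchy» v3 (d43a8bd19247ce15), whose text is at the BARE frame `0` — so
the engine lineage never owes a frame transfer, whichever text it lands:

* §4 `sameCutoffRate_of_cutoffFreeRate` — back to finite cutoffs at each pair of volumes: a cutoff-free two-volume estimate gives the same
  estimate `+ ε` for all `M ≥ M₀(L, L′, ε)` at EVERY kept label (k3c5-p3's label-uniform `klSelfEnergy_cutoffLimit_labelUniform`, any frame,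
  all `U`); `norm_klSelfEnergyInf_le_of_cutoffBound` — an `M`-eventual finite-cutoff bound passes to `Σ∞`;
* §5 **`stub_vl_carrierRate_of_framedCarrierRate (hfr) : <the registered text of stub_vl_carrierRate>`** — from the framed export `hfr`
  (= the hypothesis of `klRegimeVolumeLimitV14_of_framedCarrierRate`) and the CLOSED framed bound `stub_vl_bound` (k3c4-p2 p495604):
  cutoff-free framed rate (`kler_carrierRate_of_sameCutoff`, any frame) and bound (§4) ⇒ bare cutoff-free rate
  (`bareCutoffFreeRate_of_framedCutoffFreeRate`, `…VolumeLimitInverseDressing`) ⇒ finite cutoffs (§4); rate `(1 + ‖K‖₀β/π)²·ρ L + 1/(L+1)`,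
  threshold `max (max L₀ L₁) 3`;
* §6 **`framedCarrierRate_of_nestedFramed (hN) (hM)`** — the framed export itself from its WEAKEST form: NESTED volumes `L ∣ L″` at the SAME
  grid point (`p_{k″} = p_k`), same cutoff, frame `K`, rate `ρ L` (hN), plus a ONE-volume torus-Lipschitz modulus of `k ↦ Σ̂^K_{L,M}((ω,k),0)`
  (hM) — k3c5-p3's abstract `twoVolumeRate_of_nestedRate_cutoff` (p499175) run on the framed carrier.  So the engine lineage's whole volume
  duty for 19921 reads: (hN) + (hM) in its own frame ⇒ `klRegimeVolumeLimitV14_of_framedCarrierRate` (route decl) and, by §5, the registered stub.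

Everything is proved; no definition; nothing is asserted about the model.
-/

noncomputable section

namespace Summit.HubbardSuperconductivity.HubbardSuperconductivity.Theorems.TwoPointAssembly

set_option linter.dupNamespace false -- summit = problem name (single-conjunct summit), D-0017

open Filter Topology Finset Literature.MathematicalPhysics.QuantumLattice Literature.Probability.LatticeModels GrassmannAlgebra
open Summit.HubbardSuperconductivity.HubbardSuperconductivity.Theorems.KLProgrammeLegKernels
open Summit.HubbardSuperconductivity.HubbardSuperconductivity.Theorems.KLRegimeSplit

variable {L : ℕ} [NeZero L]

/-! ## §4 Back to finite cutoffs, and the cutoff-free bound from an eventual finite one -/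

/-- **A cutoff-free two-volume estimate returns to finite cutoffs** (`β > 0`, `3 ≤ L, L′`, any frame `J`, any real `U`): if
`‖Σ∞^J_L(n,k) − Σ∞^J_{L′}(n,k′)‖ ≤ c n k k′` for all `n k k′`, then for every `ε > 0` there is `M₀` with
`‖Σ̂^J_{L,M}((ω,k),0) − Σ̂^J_{L′,M}((ω,k′),0)‖ ≤ c (matsubaraInt M ω) k k′ + ε` for all `M ≥ M₀` and EVERY kept label `ω` (both finite objects are
label-uniformly within `ε/2` of their limits: `klSelfEnergy_cutoffLimit_labelUniform`). -/
theorem sameCutoffRate_of_cutoffFreeRate {β : ℝ} (hβ : 0 < β) (U μ : ℝ) (J : TrigPolyC4v) {L L' : ℕ} [NeZero L] [NeZero L']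
    (hL : 3 ≤ L) (hL' : 3 ≤ L') {c : ℤ → TorusSite 2 L → TorusSite 2 L' → ℝ}
    (h : ∀ (n : ℤ) (k : TorusSite 2 L) (k' : TorusSite 2 L'), ‖klSelfEnergyInf L β U μ J n k - klSelfEnergyInf L' β U μ J n k'‖ ≤ c n k k')
    {ε : ℝ} (hε : 0 < ε) :
    ∃ M₀ : ℕ, ∀ (M : ℕ) [NeZero M], M₀ ≤ M → ∀ (ω : MatsubaraIdx M) (k : TorusSite 2 L) (k' : TorusSite 2 L'),
      ‖klSelfEnergy L M β U μ J klE0 (nScales β + 1) (ω, k) 0 - klSelfEnergy L' M β U μ J klE0 (nScales β + 1) (ω, k') 0‖ ≤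
        c (matsubaraInt M ω) k k' + ε := by
  obtain ⟨M₁, hM₁⟩ := klSelfEnergy_cutoffLimit_labelUniform hL hβ U μ J (half_pos hε)
  obtain ⟨M₁', hM₁'⟩ := klSelfEnergy_cutoffLimit_labelUniform hL' hβ U μ J (half_pos hε)
  refine ⟨max M₁ M₁', fun M _ hM ω k k' => ?_⟩
  have h1 := hM₁ M (le_of_max_le_left hM) ω k 0
  have h1' := hM₁' M (le_of_max_le_right hM) ω k' 0
  have h0 := h (matsubaraInt M ω) k k'
  calc ‖klSelfEnergy L M β U μ J klE0 (nScales β + 1) (ω, k) 0 - klSelfEnergy L' M β U μ J klE0 (nScales β + 1) (ω, k') 0‖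
      = ‖(klSelfEnergyInf L β U μ J (matsubaraInt M ω) k - klSelfEnergyInf L' β U μ J (matsubaraInt M ω) k') +
          (klSelfEnergy L M β U μ J klE0 (nScales β + 1) (ω, k) 0 - klSelfEnergyInf L β U μ J (matsubaraInt M ω) k) -
          (klSelfEnergy L' M β U μ J klE0 (nScales β + 1) (ω, k') 0 - klSelfEnergyInf L' β U μ J (matsubaraInt M ω) k')‖ := by
        congr 1; ring
    _ ≤ ‖klSelfEnergyInf L β U μ J (matsubaraInt M ω) k - klSelfEnergyInf L' β U μ J (matsubaraInt M ω) k'‖ +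
          ‖klSelfEnergy L M β U μ J klE0 (nScales β + 1) (ω, k) 0 - klSelfEnergyInf L β U μ J (matsubaraInt M ω) k‖ +
          ‖klSelfEnergy L' M β U μ J klE0 (nScales β + 1) (ω, k') 0 - klSelfEnergyInf L' β U μ J (matsubaraInt M ω) k'‖ :=
        (norm_sub_le _ _).trans (add_le_add (norm_add_le _ _) le_rfl)
    _ ≤ c (matsubaraInt M ω) k k' + ε / 2 + ε / 2 := add_le_add_three h0 h1 h1'
    _ = c (matsubaraInt M ω) k k' + ε := by ring

/-- **An `M`-eventual finite-cutoff bound passes to the cutoff-free carrier** (`3 ≤ L`, `β > 0`, any frame `J`, any real `U`): if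
`‖Σ̂^J_{L,M}(k,σ)‖ ≤ B` for all `M ≥ Mth` and all labels, then `‖Σ∞^J_L(n,p)‖ ≤ B` for every Matsubara integer `n`. -/
theorem norm_klSelfEnergyInf_le_of_cutoffBound (hL : 3 ≤ L) {β : ℝ} (hβ : 0 < β) (U μ : ℝ) (J : TrigPolyC4v) {B : ℝ} {Mth : ℕ}
    (h : ∀ (M : ℕ) [NeZero M], Mth ≤ M → ∀ (k : FreqMomentum L M) (σ : Fin 2), ‖klSelfEnergy L M β U μ J klE0 (nScales β + 1) k σ‖ ≤ B)
    (n : ℤ) (p : TorusSite 2 L) : ‖klSelfEnergyInf L β U μ J n p‖ ≤ B := by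
  refine le_of_forall_pos_le_add fun ε hε => ?_
  obtain ⟨M₁, hM₁⟩ := klSelfEnergy_cutoffLimit_labelUniform hL hβ U μ J hε
  set M : ℕ := max (max Mth M₁) (n.natAbs + 1) with hM
  haveI : NeZero M := ⟨by omega⟩
  have hnM : n.natAbs < M := by omega
  obtain ⟨ω, hω⟩ := klvc_exists_matsubaraIdx hnM
  have h0 := h M (by omega) (ω, p) 0
  have h1 := hM₁ M (by omega) ω p 0
  rw [hω] at h1
  calc ‖klSelfEnergyInf L β U μ J n p‖
      = ‖klSelfEnergy L M β U μ J klE0 (nScales β + 1) (ω, p) 0 -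
          (klSelfEnergy L M β U μ J klE0 (nScales β + 1) (ω, p) 0 - klSelfEnergyInf L β U μ J n p)‖ := by congr 1; ring
    _ ≤ ‖klSelfEnergy L M β U μ J klE0 (nScales β + 1) (ω, p) 0‖ +
          ‖klSelfEnergy L M β U μ J klE0 (nScales β + 1) (ω, p) 0 - klSelfEnergyInf L β U μ J n p‖ := norm_sub_le _ _
    _ ≤ B + ε := add_le_add h0 h1

end Summit.HubbardSuperconductivity.HubbardSuperconductivity.Theorems.TwoPointAssembly

/-! ## §5 The registered bare stub from the framed export -/

namespace Summit.HubbardSuperconductivity.HubbardSuperconductivity.Theorems.KLRegimeVolumeLimit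

set_option linter.dupNamespace false -- summit = problem name (single-conjunct summit), D-0017

open Filter Topology Finset Literature.MathematicalPhysics.QuantumLattice Literature.Probability.LatticeModels GrassmannAlgebra
open Summit.HubbardSuperconductivity.HubbardSuperconductivity.Theorems.KLProgrammeLegKernels
open Summit.HubbardSuperconductivity.HubbardSuperconductivity.Theorems.KLRegimeSplit
open Summit.HubbardSuperconductivity.HubbardSuperconductivity.Theorems.TwoPointAssembly

/-- **DOOR: the REGISTERED `stub_vl_carrierRate` (skeleton «cauchy» v3, bare frame) FROM THE FRAMED EXPORT.**  If, under the child's binders,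
the last-scale two-leg kernel IN THE ADMISSIBLE FRAME `K` has a same-cutoff two-volume rate with cross-grid torus modulus beyond a threshold
`M₀(L, L′)` (the hypothesis of `klRegimeVolumeLimitV14_of_framedCarrierRate`), then so does the BARE-frame carrier — the registered text
verbatim (rate `(1 + ‖K‖₀β/π)²·ρ L + 1/(L+1)`; framed bound from the closed `stub_vl_bound`; frame transfer at `M = ∞`, §3; return to finite
cutoffs, §4).  With it the registered skeleton closes from either export. -/
theorem stub_vl_carrierRate_of_framedCarrierRate
    (hfr : ∀ (G : GeoConsts) (P : SplitConsts) (Q : EngConsts) (R : RenConsts), G.WF → P.WF → Q.WF → R.WF →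
      ∃ c₅ : ℝ, 0 < c₅ ∧ ∀ c : ℝ, 0 < c → c ≤ c₅ → ∃ U₀ : ℝ, 0 < U₀ ∧
        ∀ μ ∈ klWindowC, ∀ U : ℝ, 0 < U → U ≤ U₀ → ∀ β : ℝ, klBetaMin ≤ β → β ≤ Real.exp (c / U ^ 2) →
          ∀ K : TrigPolyC4v, klPredsV14.frameOK R U (nScales β) μ K →
            ∀ (Lstar : ℕ) (Mstar : ℕ → ℕ), TowerP klPredsV14 G P Q R β U μ K Lstar Mstar →
              ∃ L₀ : ℕ, ∃ D : ℝ, ∃ ρ : ℕ → ℝ, Tendsto ρ atTop (𝓝 0) ∧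
                ∀ (L : ℕ) [NeZero L], L₀ ≤ L → ∀ (L' : ℕ) [NeZero L'], L ≤ L' → ∃ M₀ : ℕ, ∀ (M : ℕ) [NeZero M], M₀ ≤ M →
                  ∀ (ω : MatsubaraIdx M) (k : TorusSite 2 L) (k' : TorusSite 2 L'),
                    ‖klSelfEnergy L M β U μ K klE0 (nScales β + 1) (ω, k) 0 -
                        klSelfEnergy L' M β U μ K klE0 (nScales β + 1) (ω, k') 0‖ ≤
                      ρ L + D * ∑ i, torusAbs (latticeMomentum L k i - latticeMomentum L' k' i)) :
    ∀ (G : GeoConsts) (P : SplitConsts) (Q : EngConsts) (R : RenConsts), G.WF → P.WF → Q.WF → R.WF →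
      ∃ c₅ : ℝ, 0 < c₅ ∧ ∀ c : ℝ, 0 < c → c ≤ c₅ → ∃ U₀ : ℝ, 0 < U₀ ∧
        ∀ μ ∈ klWindowC, ∀ U : ℝ, 0 < U → U ≤ U₀ → ∀ β : ℝ, klBetaMin ≤ β → β ≤ Real.exp (c / U ^ 2) →
          ∀ K : TrigPolyC4v, klPredsV14.frameOK R U (nScales β) μ K →
            ∀ (Lstar : ℕ) (Mstar : ℕ → ℕ), TowerP klPredsV14 G P Q R β U μ K Lstar Mstar →
              ∃ L₀ : ℕ, ∃ D : ℝ, ∃ ρ : ℕ → ℝ, Tendsto ρ atTop (𝓝 0) ∧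
                ∀ (L : ℕ) [NeZero L], L₀ ≤ L → ∀ (L' : ℕ) [NeZero L'], L ≤ L' → ∃ M₀ : ℕ, ∀ (M : ℕ) [NeZero M], M₀ ≤ M →
                  ∀ (ω : MatsubaraIdx M) (k : TorusSite 2 L) (k' : TorusSite 2 L'),
                    ‖klSelfEnergy L M β U μ 0 klE0 (nScales β + 1) (ω, k) 0 -
                        klSelfEnergy L' M β U μ 0 klE0 (nScales β + 1) (ω, k') 0‖ ≤
                      ρ L + D * ∑ i, torusAbs (latticeMomentum L k i - latticeMomentum L' k' i) := by
  intro G P Q R hG hP hQ hR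
  obtain ⟨c₁, hc₁, h₁⟩ := hfr G P Q R hG hP hQ hR
  obtain ⟨c₂, hc₂, h₂⟩ := stub_vl_bound G P Q R hG hP hQ hR
  refine ⟨min c₁ c₂, lt_min hc₁ hc₂, fun c hc hcle => ?_⟩
  obtain ⟨U₁, hU₁, h₁'⟩ := h₁ c hc (hcle.trans (min_le_left _ _))
  obtain ⟨U₂, hU₂, h₂'⟩ := h₂ c hc (hcle.trans (min_le_right _ _))
  refine ⟨min U₁ U₂, lt_min hU₁ hU₂, ?_⟩
  intro μ hμ U hU hUle β hβmin hβle K hK Lstar Mstar hT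
  have hβ : 0 < β := KLRegimeSplit.pos_of_klBetaMin_le hβmin
  have hK' : FrameOK R U (nScales β) μ K := hK
  obtain ⟨L₁, D, ρ, hρ, hS⟩ := h₁' μ hμ U hU (hUle.trans (min_le_left _ _)) β hβmin hβle K hK Lstar Mstar hT
  -- the cutoff-free framed rate beyond `max L₁ 3` (any frame: `kler_carrierRate_of_sameCutoff`)
  have hrate : ∀ (L : ℕ) [NeZero L], max L₁ 3 ≤ L → ∀ (L' : ℕ) [NeZero L'], L ≤ L' →
      ∀ (n : ℤ) (k : TorusSite 2 L) (k' : TorusSite 2 L'),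
        ‖klSelfEnergyInf L β U μ K n k - klSelfEnergyInf L' β U μ K n k'‖ ≤
          ρ L + D * ∑ i, torusAbs (latticeMomentum L k i - latticeMomentum L' k' i) := by
    intro L _ hL L' _ hLL' n k k'
    have hL3 : 3 ≤ L := le_of_max_le_right hL
    obtain ⟨M₀, hM₀⟩ := hS L (le_of_max_le_left hL) L' hLL'
    exact kler_carrierRate_of_sameCutoff hβ U μ K hL3 (hL3.trans hLL') ⟨M₀, fun M _ hM ω _ => hM₀ M hM ω k k'⟩
  obtain ⟨B, L₂, Mth, hB⟩ := h₂' μ hμ U hU (hUle.trans (min_le_right _ _)) β hβmin hβle K hK Lstar Mstar hT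
  -- common threshold `L₀ = max (max L₁ L₂) 3`; the framed cutoff-free bound and rate beyond it
  set L₀ : ℕ := max (max L₁ L₂) 3 with hL₀
  have hBinf : ∀ (L : ℕ) [NeZero L], L₀ ≤ L → ∀ (n : ℤ) (k : TorusSite 2 L), ‖klSelfEnergyInf L β U μ K n k‖ ≤ B := by
    intro L _ hL n k
    exact norm_klSelfEnergyInf_le_of_cutoffBound (le_of_max_le_right hL) hβ U μ K
      (fun M _ hM q σ => hB L (le_of_max_le_right (le_of_max_le_left hL)) M hM q σ) n k
  have hrate' : ∀ (L : ℕ) [NeZero L], L₀ ≤ L → ∀ (L' : ℕ) [NeZero L'], L ≤ L' →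
      ∀ (n : ℤ) (k : TorusSite 2 L) (k' : TorusSite 2 L'),
        ‖klSelfEnergyInf L β U μ K n k - klSelfEnergyInf L' β U μ K n k'‖ ≤
          ρ L + D * ∑ i, torusAbs (latticeMomentum L k i - latticeMomentum L' k' i) :=
    fun L _ hL L' _ hLL' n k k' => hrate L (max_le (le_of_max_le_left (le_of_max_le_left hL)) (le_of_max_le_right hL)) L' hLL' n k k'
  -- frame transfer at `M = ∞`
  obtain ⟨D', ρ', hρ', hbare⟩ := bareCutoffFreeRate_of_framedCutoffFreeRate hβ hK' U hρ hrate' hBinf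
  -- back to finite cutoffs, with slack `1/(L+1)`
  refine ⟨L₀, D', fun L => ρ' L + 1 / ((L : ℝ) + 1), ?_, ?_⟩
  · simpa using hρ'.add tendsto_one_div_add_atTop_nhds_zero_nat
  intro L _ hL L' _ hLL'
  have hL3 : 3 ≤ L := le_of_max_le_right hL
  have hε : (0 : ℝ) < 1 / ((L : ℝ) + 1) := by positivity
  obtain ⟨M₀, hM₀⟩ := sameCutoffRate_of_cutoffFreeRate hβ U μ 0 hL3 (hL3.trans hLL')
    (c := fun n k k' => ρ' L + D' * ∑ i, torusAbs (latticeMomentum L k i - latticeMomentum L' k' i))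
    (fun n k k' => hbare L hL L' hLL' n k k') hε
  refine ⟨M₀, fun M _ hM ω k k' => ?_⟩
  have h := hM₀ M hM ω k k'
  linarith

/-! ## §6 The framed export from nested volumes at the same grid point + a one-volume modulus -/

/-- **THE FRAMED EXPORT FROM ITS WEAKEST FORM: nested volumes, same grid point, same cutoff, frame `K` + a one-volume modulus.**  IF, under the
child's binders, (hN) for `L₀ ≤ L ∣ L″` and all `M ≥ M₀(L, L″)`, `‖Σ̂^K_{L,M}((ω,k),0) − Σ̂^K_{L″,M}((ω,k″),0)‖ ≤ ρ L` whenever `p_{k″} = p_k`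
(`ρ → 0`), and (hM) for `L₀ ≤ L` and all `M ≥ M₀(L)`, `‖Σ̂^K_{L,M}((ω,k₁),0) − Σ̂^K_{L,M}((ω,k₂),0)‖ ≤ ρ′ L + D·Σ_i |p_{k₁} i − p_{k₂} i|_𝕋`
(`ρ′ → 0`), THEN the framed export (hypothesis of `klRegimeVolumeLimitV14_of_framedCarrierRate` and of §5) holds: general pairs `L ≤ L′`
through the common multiple `L·L′` (k3c5-p3's `twoVolumeRate_of_nestedRate_cutoff`). -/
theorem framedCarrierRate_of_nestedFramed
    (hN : ∀ (G : GeoConsts) (P : SplitConsts) (Q : EngConsts) (R : RenConsts), G.WF → P.WF → Q.WF → R.WF →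
      ∃ c₅ : ℝ, 0 < c₅ ∧ ∀ c : ℝ, 0 < c → c ≤ c₅ → ∃ U₀ : ℝ, 0 < U₀ ∧
        ∀ μ ∈ klWindowC, ∀ U : ℝ, 0 < U → U ≤ U₀ → ∀ β : ℝ, klBetaMin ≤ β → β ≤ Real.exp (c / U ^ 2) →
          ∀ K : TrigPolyC4v, klPredsV14.frameOK R U (nScales β) μ K →
            ∀ (Lstar : ℕ) (Mstar : ℕ → ℕ), TowerP klPredsV14 G P Q R β U μ K Lstar Mstar →
              ∃ L₀ : ℕ, ∃ ρ : ℕ → ℝ, Tendsto ρ atTop (𝓝 0) ∧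
                ∀ (L : ℕ) [NeZero L], L₀ ≤ L → ∀ (L'' : ℕ) [NeZero L''], L ∣ L'' → ∃ M₀ : ℕ, ∀ (M : ℕ) [NeZero M], M₀ ≤ M →
                  ∀ (ω : MatsubaraIdx M) (k : TorusSite 2 L) (k'' : TorusSite 2 L''), latticeMomentum L'' k'' = latticeMomentum L k →
                    ‖klSelfEnergy L M β U μ K klE0 (nScales β + 1) (ω, k) 0 -
                        klSelfEnergy L'' M β U μ K klE0 (nScales β + 1) (ω, k'') 0‖ ≤ ρ L)
    (hM : ∀ (G : GeoConsts) (P : SplitConsts) (Q : EngConsts) (R : RenConsts), G.WF → P.WF → Q.WF → R.WF →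
      ∃ c₅ : ℝ, 0 < c₅ ∧ ∀ c : ℝ, 0 < c → c ≤ c₅ → ∃ U₀ : ℝ, 0 < U₀ ∧
        ∀ μ ∈ klWindowC, ∀ U : ℝ, 0 < U → U ≤ U₀ → ∀ β : ℝ, klBetaMin ≤ β → β ≤ Real.exp (c / U ^ 2) →
          ∀ K : TrigPolyC4v, klPredsV14.frameOK R U (nScales β) μ K →
            ∀ (Lstar : ℕ) (Mstar : ℕ → ℕ), TowerP klPredsV14 G P Q R β U μ K Lstar Mstar →
              ∃ L₀ : ℕ, ∃ D : ℝ, ∃ ρ' : ℕ → ℝ, Tendsto ρ' atTop (𝓝 0) ∧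
                ∀ (L : ℕ) [NeZero L], L₀ ≤ L → ∃ M₀ : ℕ, ∀ (M : ℕ) [NeZero M], M₀ ≤ M →
                  ∀ (ω : MatsubaraIdx M) (k₁ k₂ : TorusSite 2 L),
                    ‖klSelfEnergy L M β U μ K klE0 (nScales β + 1) (ω, k₁) 0 -
                        klSelfEnergy L M β U μ K klE0 (nScales β + 1) (ω, k₂) 0‖ ≤
                      ρ' L + D * ∑ i, torusAbs (latticeMomentum L k₁ i - latticeMomentum L k₂ i)) :
    ∀ (G : GeoConsts) (P : SplitConsts) (Q : EngConsts) (R : RenConsts), G.WF → P.WF → Q.WF → R.WF →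
      ∃ c₅ : ℝ, 0 < c₅ ∧ ∀ c : ℝ, 0 < c → c ≤ c₅ → ∃ U₀ : ℝ, 0 < U₀ ∧
        ∀ μ ∈ klWindowC, ∀ U : ℝ, 0 < U → U ≤ U₀ → ∀ β : ℝ, klBetaMin ≤ β → β ≤ Real.exp (c / U ^ 2) →
          ∀ K : TrigPolyC4v, klPredsV14.frameOK R U (nScales β) μ K →
            ∀ (Lstar : ℕ) (Mstar : ℕ → ℕ), TowerP klPredsV14 G P Q R β U μ K Lstar Mstar →
              ∃ L₀ : ℕ, ∃ D : ℝ, ∃ ρ : ℕ → ℝ, Tendsto ρ atTop (𝓝 0) ∧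
                ∀ (L : ℕ) [NeZero L], L₀ ≤ L → ∀ (L' : ℕ) [NeZero L'], L ≤ L' → ∃ M₀ : ℕ, ∀ (M : ℕ) [NeZero M], M₀ ≤ M →
                  ∀ (ω : MatsubaraIdx M) (k : TorusSite 2 L) (k' : TorusSite 2 L'),
                    ‖klSelfEnergy L M β U μ K klE0 (nScales β + 1) (ω, k) 0 -
                        klSelfEnergy L' M β U μ K klE0 (nScales β + 1) (ω, k') 0‖ ≤
                      ρ L + D * ∑ i, torusAbs (latticeMomentum L k i - latticeMomentum L' k' i) := by
  intro G P Q R hG hP hQ hR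
  obtain ⟨c₁, hc₁, h₁⟩ := hN G P Q R hG hP hQ hR
  obtain ⟨c₂, hc₂, h₂⟩ := hM G P Q R hG hP hQ hR
  refine ⟨min c₁ c₂, lt_min hc₁ hc₂, fun c hc hcle => ?_⟩
  obtain ⟨U₁, hU₁, h₁'⟩ := h₁ c hc (hcle.trans (min_le_left _ _))
  obtain ⟨U₂, hU₂, h₂'⟩ := h₂ c hc (hcle.trans (min_le_right _ _))
  refine ⟨min U₁ U₂, lt_min hU₁ hU₂, ?_⟩
  intro μ hμ U hU hUle β hβ hβle K hK Lstar Mstar hT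
  obtain ⟨L₁, ρ, hρ, hnest⟩ := h₁' μ hμ U hU (hUle.trans (min_le_left _ _)) β hβ hβle K hK Lstar Mstar hT
  obtain ⟨L₂, D, ρ', hρ', hmod⟩ := h₂' μ hμ U hU (hUle.trans (min_le_right _ _)) β hβ hβle K hK Lstar Mstar hT
  obtain ⟨ρ₂, hρ₂, hrate⟩ := twoVolumeRate_of_nestedRate_cutoff
    (T := fun L M _ _ ω k => klSelfEnergy L M β U μ K klE0 (nScales β + 1) (ω, k) 0) (L₀ := max L₁ L₂) (D := D) hρ hρ'
    (fun L _ hL L'' _ hdvd => hnest L (le_of_max_le_left hL) L'' hdvd) (fun L _ hL => hmod L (le_of_max_le_right hL))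
  exact ⟨max L₁ L₂, D, ρ₂, hρ₂, fun L _ hL L' _ hLL' => hrate L hL L' hLL'⟩

end Summit.HubbardSuperconductivity.HubbardSuperconductivity.Theorems.KLRegimeVolumeLimit

end
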